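import Literature.IUT.HodgeTheaters.GaloisValDatumCoveringMonoid
import HarnessLib

/-!
# `Φ_{C⊢_v}(Ã) ≅ ℕ`: the divisor homomorphism `𝒪^×_{K̄_v}·q̲^ℕ → ℕ`, `u·q̲^n ↦ n`, with kernel `𝒪^×_{K̄_v}`, `G_v`-invariant
# (the split monoid `𝒪^▷_{C⊢_v}(Ã) = 𝒪^× × q̲^ℕ` of the GENUINE `C⊢_v` at the universal covering)

Mochizuki, *Inter-universal Teichmüller Theory I*, kurims manuscript (May 2020), Ex. 3.2 (iv) p. 71 «the resulting
submonoid `Φ_{C⊢_v} := ℕ·log_Φ(q̲_v)|_{D⊢_v}` … a `p_v`-adic Frobenioid … whose divisor monoid is constant `≅ ℕ`»,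
(v) p. 72 «`𝒪^▷(−) = 𝒪^×(−)·q̲_v^ℕ`» [cite: Mochizuki2012, I Ex 3.2 (iv)(v) pp.71-72] (D-0012 claim key, status disputed;
nothing of the series is asserted); [FrdII] Ex. 1.1 (i)(ii) pp. 7–8 [cite: MochizukiFrdII2008, Ex 1.1 (ii) p.8].

Cell abc-iut, seat abc-iut-L5-t2 (gen 7); row «B16-i», follow-up (γ) of `GaloisValDatumCoveringMonoid.lean` (p456702).
One `def` (`dashOrd`, the exponent) + one `def` (`dashOrdHom`) + theorems; 0 instances / notation / `Prop` facts.
WHAT IS PROVED: for `q ∈ 𝒪^▷_{K_v}` NOT a unit, the exponent `n` in `x = u·q^n ∈ 𝒪^×_{K̄_v}·q^ℕ` is UNIQUE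
(`dashCovering_exponent_unique`: `𝒪^▷_{K̄_v}` is cancellative and `q` is not a unit of `𝒪^▷_{K̄_v}` since the valuation
of `K̄_v` extends that of `K_v`); `dashOrdHom : 𝒪^×·q^ℕ →* ℕ` is a monoid homomorphism with `dashOrd q̲ = 1`
(`dashOrd_toΩ`: SURJECTIVE onto `ℕ = Φ_{C⊢_v}(Ã)`), kernel exactly the units (`dashOrd_eq_zero_iff`: `𝒪^×_{K̄_v}`), and
INVARIANT under `G_v` (`dashOrd_dashAct`: the divisor monoid of `C⊢_v` carries the trivial Galois action); at the
InitialThetaData datum: `InitialThetaData.badDashOrd`.  HONEST FRAMING as in the parent file; no side taken on [IUTchIII]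
Cor. 3.12; typed ≠ proved for anything else.
-/

noncomputable section

open scoped Classical

namespace Literature.IUT.HodgeTheaters

open CategoryTheory NumberField IsDedekindDomain Literature.AnabelianGeometry.SemiGraphs
  Literature.AlgebraicGeometry.Frobenioids Literature.AlgebraicGeometry.Frobenioids.PadicFrd
  Literature.IUT.HodgeArakelov

universe u

namespace GaloisValDatum

variable {p : ℕ} [Fact p.Prime] (d : GaloisValDatum.{u} p)

/-! ### Uniqueness of the exponent -/

/-- `𝒪^▷_{K̄_v}` is cancellative (a submonoid of the nonzero elements of the field `K̄_v`).
[cite: MochizukiFrdII2008, Ex 1.1 (i) p.7] -/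
theorem intNonzero_mul_right_cancel {a b c : intNonzero d.Ω} (h : a * b = c * b) : a = c :=
  Subtype.ext (mul_right_cancel₀ b.2.2 (by
    have h' := congrArg Subtype.val h
    simpa only [Submonoid.coe_mul] using h'))

/-- If `u·q^m = u'·q^n` with `u` a unit and `m < n`, then `q` is a unit of `𝒪^▷_{K̄_v}`.
[cite: MochizukiFrdII2008, Ex 1.1 (i) p.7] -/
theorem isUnit_toΩ_of_eq (q : intNonzero d.k) {m n : ℕ} (hmn : m < n) {u u' : intNonzero d.Ω} (hu : IsUnit u)
    (h : u * d.toΩ q ^ m = u' * d.toΩ q ^ n) : IsUnit (d.toΩ q) := by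
  obtain ⟨k, rfl⟩ := Nat.exists_eq_add_of_lt hmn
  have h' : u = u' * d.toΩ q ^ (k + 1) := by
    apply d.intNonzero_mul_right_cancel (b := d.toΩ q ^ m)
    rw [h, mul_assoc, ← pow_add, Nat.add_comm (k + 1) m, Nat.add_assoc]
  have hunit : IsUnit (d.toΩ q ^ (k + 1)) := isUnit_of_mul_isUnit_right (h' ▸ hu)
  exact (isUnit_pow_iff (Nat.succ_ne_zero k)).mp hunit

/-- **Uniqueness of the exponent**: for `q ∈ 𝒪^▷_{K_v}` NOT a unit, `u·q^m = u'·q^n` with units `u, u'` forces `m = n`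
(«the divisor monoid `ℕ·log_Φ(q̲_v)` is `≅ ℕ`»). [cite: Mochizuki2012, I Ex 3.2 (iv) p.71] -/
theorem dashCovering_exponent_unique {q : intNonzero d.k} (hq : ¬ IsUnit q) {m n : ℕ} {u u' : intNonzero d.Ω}
    (hu : IsUnit u) (hu' : IsUnit u') (h : u * d.toΩ q ^ m = u' * d.toΩ q ^ n) : m = n := by
  rcases lt_trichotomy m n with hmn | rfl | hnm
  · exact absurd (d.isUnit_toΩ_of_eq q hmn hu h) (d.not_isUnit_toΩ hq)
  · rfl
  · exact absurd (d.isUnit_toΩ_of_eq q hnm hu' h.symm) (d.not_isUnit_toΩ hq)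

/-! ### The divisor homomorphism `𝒪^×·q̲^ℕ → ℕ` -/

variable {q : intNonzero d.k} (hq : ¬ IsUnit q)

/-- **The exponent `n` of `x = u·q̲^n ∈ 𝒪^×_{K̄_v}·q̲^ℕ`** (the divisor of `x` in `Φ_{C⊢_v}(Ã) = ℕ·log_Φ(q̲_v) ≅ ℕ`).
[cite: Mochizuki2012, I Ex 3.2 (iv) p.71] -/
def dashOrd (_hq : ¬ IsUnit q) (x : d.dashCovering q) : ℕ := Classical.choose x.2

/-- The defining property of `dashOrd`. [cite: Mochizuki2012, I Ex 3.2 (iv) p.71] -/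
theorem dashOrd_spec (x : d.dashCovering q) :
    ∃ u : intNonzero d.Ω, IsUnit u ∧ (x : intNonzero d.Ω) = u * d.toΩ q ^ d.dashOrd hq x :=
  Classical.choose_spec x.2

/-- `dashOrd` is characterised by ANY presentation `x = u·q̲^n` (uniqueness of the exponent).
[cite: Mochizuki2012, I Ex 3.2 (iv) p.71] -/
theorem dashOrd_eq_of_eq (x : d.dashCovering q) {n : ℕ} {u : intNonzero d.Ω} (hu : IsUnit u)
    (h : (x : intNonzero d.Ω) = u * d.toΩ q ^ n) : d.dashOrd hq x = n := by
  obtain ⟨u', hu', h'⟩ := d.dashOrd_spec hq x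
  exact d.dashCovering_exponent_unique hq hu' hu (h'.symm.trans h)

/-- `dashOrd 1 = 0`. [cite: Mochizuki2012, I Ex 3.2 (iv) p.71] -/
theorem dashOrd_one : d.dashOrd hq 1 = 0 :=
  d.dashOrd_eq_of_eq hq 1 isUnit_one (by rw [pow_zero, mul_one]; rfl)

/-- `dashOrd` is additive. [cite: Mochizuki2012, I Ex 3.2 (iv) p.71] -/
theorem dashOrd_mul (x y : d.dashCovering q) : d.dashOrd hq (x * y) = d.dashOrd hq x + d.dashOrd hq y := by
  obtain ⟨u, hu, hx⟩ := d.dashOrd_spec hq x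
  obtain ⟨u', hu', hy⟩ := d.dashOrd_spec hq y
  refine d.dashOrd_eq_of_eq hq (x * y) (hu.mul hu') ?_
  rw [Submonoid.coe_mul, hx, hy, pow_add, mul_mul_mul_comm]

/-- **`Φ_{C⊢_v}(Ã) ≅ ℕ`: the divisor homomorphism `𝒪^×_{K̄_v}·q̲^ℕ →* ℕ`, `u·q̲^n ↦ n`.**
[cite: Mochizuki2012, I Ex 3.2 (iv) p.71] -/
def dashOrdHom : ↥(d.dashCovering q) →* Multiplicative ℕ where
  toFun x := Multiplicative.ofAdd (d.dashOrd hq x)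
  map_one' := by rw [d.dashOrd_one hq]; rfl
  map_mul' x y := by rw [d.dashOrd_mul hq, ofAdd_add]

/-- Values of `dashOrdHom`. [cite: Mochizuki2012, I Ex 3.2 (iv) p.71] -/
@[simp] theorem dashOrdHom_apply (x : d.dashCovering q) : d.dashOrdHom hq x = Multiplicative.ofAdd (d.dashOrd hq x) := rfl

/-- **`dashOrd q̲ = 1`**: the generator `log_Φ(q̲_v)`; hence `dashOrdHom` is SURJECTIVE. [cite: Mochizuki2012, I Ex 3.2 (iv) p.71] -/
theorem dashOrd_toΩ : d.dashOrd hq ⟨d.toΩ q, d.toΩ_mem_dashCovering q⟩ = 1 :=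
  d.dashOrd_eq_of_eq hq _ isUnit_one (by rw [pow_one, one_mul])

/-- `dashOrdHom` is surjective onto `ℕ`. [cite: Mochizuki2012, I Ex 3.2 (iv) p.71] -/
theorem dashOrdHom_surjective : Function.Surjective (d.dashOrdHom hq) := fun n => by
  refine ⟨⟨d.toΩ q, d.toΩ_mem_dashCovering q⟩ ^ (Multiplicative.toAdd n), ?_⟩
  rw [map_pow, dashOrdHom_apply, dashOrd_toΩ, ← ofAdd_nsmul, smul_eq_mul, mul_one, ofAdd_toAdd]

/-- **The kernel of the divisor homomorphism is `𝒪^×_{K̄_v}`**: `dashOrd x = 0 ↔ x` is a unit of `𝒪^▷_{K̄_v}`.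
[cite: MochizukiFrdII2008, Ex 1.1 (i) p.7] -/
theorem dashOrd_eq_zero_iff (x : d.dashCovering q) : d.dashOrd hq x = 0 ↔ IsUnit (x : intNonzero d.Ω) := by
  constructor
  · intro h
    obtain ⟨u, hu, hx⟩ := d.dashOrd_spec hq x
    rw [h, pow_zero, mul_one] at hx
    rw [hx]; exact hu
  · intro h
    exact d.dashOrd_eq_of_eq hq x h (by rw [pow_zero, mul_one])

/-- **`G_v`-INVARIANCE of the divisor**: `dashOrd (σ·x) = dashOrd x` — the divisor monoid `Φ_{C⊢_v}(Ã) ≅ ℕ` carries the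
trivial Galois action (`σ(u·q̲^n) = σ(u)·q̲^n`). [cite: Mochizuki2012, II Def 4.9 (i) p.154] -/
theorem dashOrd_dashAct (σ : d.Gal) (x : d.dashCovering q) : d.dashOrd hq (d.dashAct q σ x) = d.dashOrd hq x := by
  obtain ⟨u, hu, hx⟩ := d.dashOrd_spec hq x
  refine d.dashOrd_eq_of_eq hq _ ((d.isUnit_galAct_iff σ u).mpr hu) ?_
  change d.galAct σ (x : intNonzero d.Ω) = _
  rw [hx, map_mul, map_pow, galAct_toΩ]

/-- Every element of `𝒪^×·q̲^ℕ` is `u·q̲^{dashOrd x}` with `u` a UNIT — the splitting `𝒪^▷_{C⊢_v}(Ã) = 𝒪^×_{K̄_v} × q̲^ℕ`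
(«`𝒪^▷(−) = 𝒪^×(−)·q̲_v^ℕ`»). [cite: Mochizuki2012, I Ex 3.2 (v) p.72] -/
theorem exists_unit_mul_pow_dashOrd (x : d.dashCovering q) :
    ∃ u : (intNonzero d.Ω)ˣ, (x : intNonzero d.Ω) = u * d.toΩ q ^ d.dashOrd hq x := by
  obtain ⟨u, hu, hx⟩ := d.dashOrd_spec hq x
  obtain ⟨w, rfl⟩ := hu
  exact ⟨w, hx⟩

end GaloisValDatum

/-! ### At the genuine datum -/

namespace InitialThetaData

variable {F K Fbar : Type} [Field F] [NumberField F] [Field K] [NumberField K] [Algebra F K]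
  [Field Fbar] [Algebra F Fbar] [Algebra K Fbar] [IsScalarTower F K Fbar] {E : WeierstrassCurve F}
  [E.IsElliptic] {l : ℕ} {Pb : BadPlacePredicates K} (D : InitialThetaData F K Fbar E l Pb)
  {v : FinitePlace F} (hv : v ∈ D.VFbad) (w : HeightOneSpectrum (𝓞 K)) [w.asIdeal.LiesOver v.maximalIdeal.asIdeal]
  (p : ℕ) [Fact p.Prime] (hw : ((p : ℕ) : 𝓞 K) ∈ w.asIdeal)

/-- **The divisor homomorphism of the GENUINE `C⊢_v̲` at the universal covering**: `𝒪^×_{K̄_w}·q̲_v̲^ℕ →* ℕ`, surjective,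
kernel `𝒪^×_{K̄_w}`, `Gal(K̄_w/K_w)`-invariant (`q̲_v̲` = the genuine `2l`-th root of the Tate parameter, a non-unit).
[cite: Mochizuki2012, I Ex 3.2 (iv) p.71] -/
abbrev badDashOrdHom : ↥((GaloisValDatum.ofPlace K p w hw).dashCovering (D.qRootAt hv w p hw)) →* Multiplicative ℕ :=
  (GaloisValDatum.ofPlace K p w hw).dashOrdHom (D.qRootAt_not_isUnit hv w p hw)

/-- It is surjective and `G_v̲`-invariant, with kernel the units. [cite: Mochizuki2012, I Ex 3.2 (iv) p.71] -/
theorem badDashOrdHom_surjective_invariant :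
    Function.Surjective (D.badDashOrdHom hv w p hw) ∧
      (∀ (σ : (GaloisValDatum.ofPlace K p w hw).Gal) (x),
        D.badDashOrdHom hv w p hw ((GaloisValDatum.ofPlace K p w hw).dashAct (D.qRootAt hv w p hw) σ x) =
          D.badDashOrdHom hv w p hw x) ∧
      ∀ x, D.badDashOrdHom hv w p hw x = 1 ↔ IsUnit (x : intNonzero (GaloisValDatum.ofPlace K p w hw).Ω) :=
  ⟨GaloisValDatum.dashOrdHom_surjective _ _,
    fun σ x => congrArg Multiplicative.ofAdd (GaloisValDatum.dashOrd_dashAct _ _ σ x),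
    fun x => (GaloisValDatum.dashOrd_eq_zero_iff _ (D.qRootAt_not_isUnit hv w p hw) x)⟩

end InitialThetaData

end Literature.IUT.HodgeTheaters

end
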